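import Literature.Geometry.Kaehler.ComplexTorusIntegralHodgeLatticeLefschetzPieces
import HarnessLib

/-!
# The Lefschetz similarity on sublattices and the discriminant shift of the Lefschetz pieces:
# `disc(θ ∧ N) = c^{rk N} · disc(N)`, `disc(N'_{s+1}) = c^{rk N_s} · disc(N_s)`

Layer `Literature/Geometry/Kaehler`, namespace `Literature.Geometry.Kaehler.ComplexTorus`; lane `lit-hodgefound`
(Track 2 foundations library), seat p09, generation 47, row g47-#8. THEOREMS ONLY (0 definitions); no named fact, net debt 0.
g47-#1 (`ComplexTorusIntegralHodgeLatticeLefschetzImage`) proved the Lefschetz SIMILARITY `B_{m+2}(x ∧ θ, y ∧ θ) = c · B_m(x, y)`,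
`c = (q+1)(q+2)·d_{q+1}·d_{q+2}` (`m + 2 + q = g`), on the whole Hodge lattice and read off `disc(θ ∧ Hdgᵖ(X, ℤ)) = c^{rk} · disc Hdgᵖ(X, ℤ)`.
Here the similarity is read on ARBITRARY sublattices `N ⊆ Hᵐ(X, ℤ)` and their Lefschetz images `θ ∧ N ⊆ H^{m+2}(X, ℤ)`, and applied to the
Lefschetz pieces of g47-#3 (`N'_{s+1} = θ ∧ N_s`), completing the discriminant bookkeeping of g47-#5 along the ladder:

* §1 **`G_{θ∧N} = c · G_N`, `disc(θ ∧ N) = c^{rk N} · disc(N)`** for any sublattices `N ⊆ Hᵐ(X, ℤ)`, `N₂ ⊆ H^{m+2}(X, ℤ)` with bases `b`, `b₂`,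
  `b₂ i = (b i) ∧ θ` (`IsPolarizationType.toMatrix_restrict_eq_smul_of_coe_eq_wedge`, `….det_restrict_eq_pow_mul_det_of_coe_eq_wedge`).
* §2 **such a basis `b₂` of `θ ∧ N` exists** (`m + 1 ≤ g`: `x ↦ x ∧ θ` is injective on `Hᵐ` by hard Lefschetz and maps `N` onto `θ ∧ N`;
  `IsPolarizationType.exists_basis_coe_eq_wedge`).
* §3 the pieces: **`N'_{s+1} = θ ∧ N_s`** and **`N_0 = Hdgᵖ(X, ℤ) ∩ P^k`** from the membership predicates (`IsRiemannForm.mem_lefschetzPiece_succ_iff`,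
  `mem_lefschetzPiece_zero_iff`).
* §4 **`disc(N'_{s+1}) = c^{rk N_s} · disc(N_s)`** (`IsPolarizationType.exists_basis_det_restrict_lefschetzPiece_succ_eq`): with g47-#5
  (`∏_s disc N_s = I_p² · disc Hdgᵖ`), g47-#4 (`rk N_s = ρ_pr^{(p−s)}`) and g47-#6/#7 (`I_p = ∏ J_q`) every discriminant of the ladder is expressed
  through the primitive Hodge lattices `Hdgⁱ(X, ℤ) ∩ P^{2i}`, the type `(d_i)` and the indices `J_q`.

## References

* [cite: Lange2023AbelianVarietiesComplex, §5.4.1 Thm. 5.4.2 and (5.22)–(5.23) (PDF p. 275); §7.3.2 (1), (3); §1.5.1 (PDF p. 51)]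
* [cite: VoisinHodgeI2002, §6.2.3 Lemma 6.26, Rem. 6.27 (PDF p. 126); §6.3.2 Lemma 6.31 (PDF p. 128)]
* [cite: Huybrechts2016K3, Ch. 14 §0.1 (0.1), §0.2]
* [cite: Kitaoka1993, Ch. 5 §5.3 Prop. 5.3.3 (proof)]
-/

noncomputable section

-- `Module ℂ` / `SMulZeroClass ℂ` synthesis on `E [⋀^Fin k]→L[ℝ] ℂ` (as in `ComplexTorusLefschetzDecomposition`)
set_option maxSynthPendingDepth 3

open Module Function Complex
open LinearMap (BilinForm)
open Literature.LinearAlgebra.Alternating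
open Literature.Analysis.Complex (IsOfTypeAt typeSubmodule)

namespace Literature.Geometry.Kaehler.ComplexTorus

section Similarity

variable {ι : Type*} [Fintype ι] [DecidableEq ι] {E : Type*} [NormedAddCommGroup E] [NormedSpace ℂ E]
  {Φ : (ι → ℝ) ≃L[ℝ] E} {j n m q k p : ℕ} {η : E [⋀^Fin 2]→L[ℝ] ℝ} {d : Fin (j + 2) → ℕ}

omit [Fintype ι] [DecidableEq ι] in
/-- Re-indexing the exponent of the bundled Lefschetz power along a (propositional) equality of exponents. [folklore] -/
private theorem lefschetzPow_congr₈₈ (η : E [⋀^Fin 2]→L[ℝ] ℝ) {r₁ r₂ m k : ℕ} (hr : r₁ = r₂) (h₁ : 2 * r₁ + m = k) (h₂ : 2 * r₂ + m = k)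
    (y : E [⋀^Fin m]→L[ℝ] ℂ) : lefschetzPow η r₁ h₁ y = lefschetzPow η r₂ h₂ y := by
  subst hr
  rfl

/-! ## §1 The Lefschetz similarity on sublattices: `G_{θ∧N} = c · G_N`, `disc(θ ∧ N) = c^{rk N} · disc N` -/

/-- **`G_{θ∧N} = c · G_N`**: for sublattices `N ⊆ Hᵐ(X, ℤ)`, `N₂ ⊆ H^{m+2}(X, ℤ)` with `ℤ`-bases `b`, `b₂` related by `b₂ i = (b i) ∧ θ`, the Gram
matrix of the integral Lefschetz form `B_{m+2} = ⟨·, γ_q ∧ ·⟩` on `N₂` is `c = (q+1)(q+2)·d_{q+1}·d_{q+2}` times the Gram matrix of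
`B_m = ⟨·, γ_{q+2} ∧ ·⟩` on `N` (`m + 2 + q = g`) — the Lefschetz similarity of g47-#1 (`apply_lefschetz_linearMap`) read on any sublattice.
[cite: Lange2023AbelianVarietiesComplex, §5.4.1 (5.22) (PDF p. 275); §1.5.1 (PDF p. 51)] [cite: VoisinHodgeI2002, §6.3.2 Lemma 6.31 (PDF p. 128)] [cite: Huybrechts2016K3, Ch. 14 §0.1] -/
theorem IsPolarizationType.toMatrix_restrict_eq_smul_of_coe_eq_wedge (hd : IsPolarizationType Φ η d) (hη : IsRiemannForm Φ η)
    (hq : q ≤ j + 2) {γ : E [⋀^Fin (2 * q)]→L[ℝ] ℂ}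
    (hγ : wedgePow (ofRealForm η) q = ((q.factorial * ∏ i : Fin q, d (Fin.castLE hq i) : ℕ) : ℂ) • γ)
    (hq2 : q + 1 + 1 ≤ j + 2) {γ' : E [⋀^Fin (2 * (q + 1 + 1))]→L[ℝ] ℂ}
    (hγ' : wedgePow (ofRealForm η) (q + 1 + 1) = (((q + 1 + 1).factorial * ∏ i : Fin (q + 1 + 1), d (Fin.castLE hq2 i) : ℕ) : ℂ) • γ')
    (e : Fin n ≃ ι) (hn : m + 2 + (2 * q + (m + 2)) = n) (hn₂ : m + (2 * (q + 1 + 1) + m) = n)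
    {B : BilinForm ℤ ↥(integralForms Φ (m + 2))}
    (hB : ∀ x y : ↥(integralForms Φ (m + 2)),
      ((B x y : ℤ) : ℂ) = poincarePairing Φ e hn (x : E [⋀^Fin (m + 2)]→L[ℝ] ℂ) (γ.wedge (y : E [⋀^Fin (m + 2)]→L[ℝ] ℂ)))
    {B' : BilinForm ℤ ↥(integralForms Φ m)}
    (hB' : ∀ x y : ↥(integralForms Φ m),
      ((B' x y : ℤ) : ℂ) = poincarePairing Φ e hn₂ (x : E [⋀^Fin m]→L[ℝ] ℂ) (γ'.wedge (y : E [⋀^Fin m]→L[ℝ] ℂ)))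
    {N : Submodule ℤ ↥(integralForms Φ m)} {N₂ : Submodule ℤ ↥(integralForms Φ (m + 2))} {κ : Type*} [Fintype κ] [DecidableEq κ]
    (b : Basis κ ℤ ↥N) (b₂ : Basis κ ℤ ↥N₂)
    (hb : ∀ i, (((b₂ i : ↥N₂) : ↥(integralForms Φ (m + 2))) : E [⋀^Fin (m + 2)]→L[ℝ] ℂ) =
      (((b i : ↥N) : ↥(integralForms Φ m)) : E [⋀^Fin m]→L[ℝ] ℂ).wedge (ofRealForm η : E [⋀^Fin 2]→L[ℝ] ℂ)) :
    LinearMap.BilinForm.toMatrix b₂ (B.restrict N₂) =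
      (((q + 1) * (q + 2) * d (Fin.castLE hq2 (Fin.last q).castSucc) * d (Fin.castLE hq2 (Fin.last (q + 1))) : ℕ) : ℤ) •
        LinearMap.BilinForm.toMatrix b (B'.restrict N) := by
  ext i l
  rw [LinearMap.BilinForm.toMatrix_apply, Matrix.smul_apply, LinearMap.BilinForm.toMatrix_apply, smul_eq_mul]
  change B ((b₂ i : ↥N₂) : ↥(integralForms Φ (m + 2))) ((b₂ l : ↥N₂) : ↥(integralForms Φ (m + 2))) =
    (((q + 1) * (q + 2) * d (Fin.castLE hq2 (Fin.last q).castSucc) * d (Fin.castLE hq2 (Fin.last (q + 1))) : ℕ) : ℤ) *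
      B' ((b i : ↥N) : ↥(integralForms Φ m)) ((b l : ↥N) : ↥(integralForms Φ m))
  apply Int.cast_injective (α := ℂ)
  rw [hB, Int.cast_mul, Int.cast_natCast, hB', hb, hb]
  exact hd.poincarePairing_wedge_ofRealForm_wedge_wedge_ofRealForm_of_eq_content_smul hη hq hγ hq2 hγ' e hn hn₂ _ _

/-- **`disc(θ ∧ N) = c^{rk N} · disc(N)`**: the Gram determinants of `B_{m+2}∣θ∧N` and `B_m∣N` in bases `b₂ = b ∧ θ`, `b` differ by the factor
`c^{rk N}`, `c = (q+1)(q+2)·d_{q+1}·d_{q+2}`. [cite: Lange2023AbelianVarietiesComplex, §5.4.1 (5.22) (PDF p. 275); §1.5.1 (PDF p. 51)]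
[cite: Huybrechts2016K3, Ch. 14 §0.1] [cite: Kitaoka1993, Ch. 5 §5.3 Prop. 5.3.3 (proof)] -/
theorem IsPolarizationType.det_restrict_eq_pow_mul_det_of_coe_eq_wedge (hd : IsPolarizationType Φ η d) (hη : IsRiemannForm Φ η)
    (hq : q ≤ j + 2) {γ : E [⋀^Fin (2 * q)]→L[ℝ] ℂ}
    (hγ : wedgePow (ofRealForm η) q = ((q.factorial * ∏ i : Fin q, d (Fin.castLE hq i) : ℕ) : ℂ) • γ)
    (hq2 : q + 1 + 1 ≤ j + 2) {γ' : E [⋀^Fin (2 * (q + 1 + 1))]→L[ℝ] ℂ}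
    (hγ' : wedgePow (ofRealForm η) (q + 1 + 1) = (((q + 1 + 1).factorial * ∏ i : Fin (q + 1 + 1), d (Fin.castLE hq2 i) : ℕ) : ℂ) • γ')
    (e : Fin n ≃ ι) (hn : m + 2 + (2 * q + (m + 2)) = n) (hn₂ : m + (2 * (q + 1 + 1) + m) = n)
    {B : BilinForm ℤ ↥(integralForms Φ (m + 2))}
    (hB : ∀ x y : ↥(integralForms Φ (m + 2)),
      ((B x y : ℤ) : ℂ) = poincarePairing Φ e hn (x : E [⋀^Fin (m + 2)]→L[ℝ] ℂ) (γ.wedge (y : E [⋀^Fin (m + 2)]→L[ℝ] ℂ)))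
    {B' : BilinForm ℤ ↥(integralForms Φ m)}
    (hB' : ∀ x y : ↥(integralForms Φ m),
      ((B' x y : ℤ) : ℂ) = poincarePairing Φ e hn₂ (x : E [⋀^Fin m]→L[ℝ] ℂ) (γ'.wedge (y : E [⋀^Fin m]→L[ℝ] ℂ)))
    {N : Submodule ℤ ↥(integralForms Φ m)} {N₂ : Submodule ℤ ↥(integralForms Φ (m + 2))} {κ : Type*} [Fintype κ] [DecidableEq κ]
    (b : Basis κ ℤ ↥N) (b₂ : Basis κ ℤ ↥N₂)
    (hb : ∀ i, (((b₂ i : ↥N₂) : ↥(integralForms Φ (m + 2))) : E [⋀^Fin (m + 2)]→L[ℝ] ℂ) =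
      (((b i : ↥N) : ↥(integralForms Φ m)) : E [⋀^Fin m]→L[ℝ] ℂ).wedge (ofRealForm η : E [⋀^Fin 2]→L[ℝ] ℂ)) :
    (LinearMap.BilinForm.toMatrix b₂ (B.restrict N₂)).det =
      (((q + 1) * (q + 2) * d (Fin.castLE hq2 (Fin.last q).castSucc) * d (Fin.castLE hq2 (Fin.last (q + 1))) : ℕ) : ℤ) ^ Fintype.card κ *
        (LinearMap.BilinForm.toMatrix b (B'.restrict N)).det := by
  rw [hd.toMatrix_restrict_eq_smul_of_coe_eq_wedge hη hq hγ hq2 hγ' e hn hn₂ hB hB' b b₂ hb, Matrix.det_smul]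

/-! ## §2 A basis of `θ ∧ N` from a basis of `N` -/

omit [DecidableEq ι] in
/-- **A basis of `θ ∧ N` from a basis of `N`** (`m + 1 ≤ g`): if `N₂ ⊆ H^{m+2}(X, ℤ)` is exactly the set of `x ∧ θ`, `x ∈ N` (membership
hypothesis `hN₂`), then `x ↦ x ∧ θ` is a `ℤ`-linear ISOMORPHISM `N ≅ N₂` — onto by `hN₂`, injective by hard Lefschetz (`L¹ : Hᵐ → H^{m+2}` is
injective for `m + 1 ≤ g`) — so any basis `b` of `N` is carried to a basis `b₂` of `N₂` with `b₂ i = (b i) ∧ θ`.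
[cite: Lange2023AbelianVarietiesComplex, §7.3.2 (1), (3)] [cite: VoisinHodgeI2002, §6.2.3 Lemma 6.26, Rem. 6.27 (PDF p. 126)] -/
theorem IsPolarizationType.exists_basis_coe_eq_wedge (hd : IsPolarizationType Φ η d) (hη : IsRiemannForm Φ η) (hm : m + 1 ≤ j + 2)
    {N : Submodule ℤ ↥(integralForms Φ m)} {N₂ : Submodule ℤ ↥(integralForms Φ (m + 2))}
    (hN₂ : ∀ u : ↥(integralForms Φ (m + 2)), u ∈ N₂ ↔ ∃ v ∈ N,
      (u : E [⋀^Fin (m + 2)]→L[ℝ] ℂ) = (v : E [⋀^Fin m]→L[ℝ] ℂ).wedge (ofRealForm η : E [⋀^Fin 2]→L[ℝ] ℂ))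
    {κ : Type*} (b : Basis κ ℤ ↥N) :
    ∃ b₂ : Basis κ ℤ ↥N₂, ∀ i, (((b₂ i : ↥N₂) : ↥(integralForms Φ (m + 2))) : E [⋀^Fin (m + 2)]→L[ℝ] ℂ) =
      (((b i : ↥N) : ↥(integralForms Φ m)) : E [⋀^Fin m]→L[ℝ] ℂ).wedge (ofRealForm η : E [⋀^Fin 2]→L[ℝ] ℂ) := by
  haveI : FiniteDimensional ℝ E := Module.Finite.equiv Φ.toLinearEquiv
  haveI : FiniteDimensional ℂ E := Module.Finite.of_restrictScalars_finite ℝ ℂ E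
  have hE : finrank ℝ E = Fintype.card ι := by
    rw [← Φ.toLinearEquiv.finrank_eq, Module.finrank_fintype_fun_eq_card]
  have hg : finrank ℂ E = j + 2 := by
    have h := finrank_real_of_complex E
    rw [hE, hd.card_eq] at h
    omega
  have hnd : ∀ v : E, v ≠ 0 → ∃ w : E, η ![v, w] ≠ 0 := fun v hv ↦ by
    by_contra h
    push Not at h
    exact hv (hη.nondegenerate v h)
  have hθZ : (ofRealForm η : E [⋀^Fin 2]→L[ℝ] ℂ) ∈ integralForms Φ 2 := ofRealForm_mem_integralForms_two Φ hη.isNSForm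
  have h1 : 2 * 1 + m = m + 2 := by ring
  -- the wedge map `N → N₂`
  let W : ↥N →ₗ[ℤ] ↥N₂ :=
    (AddMonoidHom.mk' (fun x : ↥N ↦ (⟨⟨(((x : ↥N) : ↥(integralForms Φ m)) : E [⋀^Fin m]→L[ℝ] ℂ).wedge (ofRealForm η : E [⋀^Fin 2]→L[ℝ] ℂ),
        wedge_mem_integralForms Φ ((x : ↥N) : ↥(integralForms Φ m)).2 hθZ⟩, (hN₂ _).2 ⟨(x : ↥(integralForms Φ m)), x.2, rfl⟩⟩ : ↥N₂))
      (fun x y ↦ Subtype.ext (Subtype.ext (ContinuousAlternatingMap.wedge_add_left _ _ _)))).toIntLinearMap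
  have hW : ∀ x : ↥N, (((W x : ↥N₂) : ↥(integralForms Φ (m + 2))) : E [⋀^Fin (m + 2)]→L[ℝ] ℂ) =
      (((x : ↥N) : ↥(integralForms Φ m)) : E [⋀^Fin m]→L[ℝ] ℂ).wedge (ofRealForm η : E [⋀^Fin 2]→L[ℝ] ℂ) := fun _ ↦ rfl
  have hinj : Injective W := fun x y hxy ↦ by
    have h := congrArg (fun u : ↥N₂ ↦ ((u : ↥(integralForms Φ (m + 2))) : E [⋀^Fin (m + 2)]→L[ℝ] ℂ)) hxy
    simp only [hW, ← lefschetzPow_one_eq_wedge_ofRealForm η h1] at h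
    exact Subtype.ext (Subtype.ext (lefschetzPow_injective hnd h1 (by omega) h))
  have hsurj : Surjective W := fun u ↦ by
    obtain ⟨v, hv, huv⟩ := (hN₂ u).1 u.2
    exact ⟨⟨v, hv⟩, Subtype.ext (Subtype.ext huv.symm)⟩
  refine ⟨b.map (LinearEquiv.ofBijective W ⟨hinj, hsurj⟩), fun i ↦ ?_⟩
  rw [Basis.map_apply]
  exact hW (b i)

/-! ## §3 The pieces: `N'_{s+1} = θ ∧ N_s`, `N_0 = Hdgᵖ(X, ℤ) ∩ P^k` -/

omit [Fintype ι] [DecidableEq ι] in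
/-- **`N'_{s+1} = θ ∧ N_s`**: the `(s+1)`-st Lefschetz piece in degree `k + 2` consists exactly of the classes `v ∧ θ`, `v` in the `s`-th piece in
degree `k` (`L^{s+1} y = (Lˢ y) ∧ θ`; `Lˢ y` is integral). [cite: Lange2023AbelianVarietiesComplex, §7.3.2 (3); §5.4.1 (5.22) (PDF p. 275)] [cite: VoisinHodgeI2002, §6.2.3 Rem. 6.27 (PDF p. 126)] -/
theorem IsRiemannForm.mem_lefschetzPiece_succ_iff (hη : IsRiemannForm Φ η)
    (N : Fin (p + 1) → Submodule ℤ ↥(integralForms Φ k))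
    (hN : ∀ (s : Fin (p + 1)) (u : ↥(integralForms Φ k)), u ∈ N s ↔
      ∃ (m i : ℕ) (_ : i + i = m) (h : 2 * (s : ℕ) + m = k) (y : E [⋀^Fin m]→L[ℝ] ℂ),
        y ∈ integralHodgeClassesIn Φ m i ∧ y ∈ primitiveForms η m ∧ (u : E [⋀^Fin k]→L[ℝ] ℂ) = lefschetzPow η (s : ℕ) h y)
    (N' : Fin (p + 1 + 1) → Submodule ℤ ↥(integralForms Φ (k + 2)))
    (hN' : ∀ (s : Fin (p + 1 + 1)) (u : ↥(integralForms Φ (k + 2))), u ∈ N' s ↔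
      ∃ (m i : ℕ) (_ : i + i = m) (h : 2 * (s : ℕ) + m = k + 2) (y : E [⋀^Fin m]→L[ℝ] ℂ),
        y ∈ integralHodgeClassesIn Φ m i ∧ y ∈ primitiveForms η m ∧ (u : E [⋀^Fin (k + 2)]→L[ℝ] ℂ) = lefschetzPow η (s : ℕ) h y)
    (s : Fin (p + 1)) (u : ↥(integralForms Φ (k + 2))) :
    u ∈ N' (Fin.succ s) ↔ ∃ v ∈ N s,
      (u : E [⋀^Fin (k + 2)]→L[ℝ] ℂ) = (v : E [⋀^Fin k]→L[ℝ] ℂ).wedge (ofRealForm η : E [⋀^Fin 2]→L[ℝ] ℂ) := by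
  have h1 : 2 * 1 + k = k + 2 := by ring
  constructor
  · intro hu
    obtain ⟨m, i, hm, h, y, hyH, hyP, huy⟩ := (hN' (Fin.succ s) u).1 hu
    have h₀ : 2 * (s : ℕ) + m = k := by simp at h; omega
    refine ⟨⟨lefschetzPow η s h₀ y, lefschetzPow_mem_integralForms hη h₀ ((mem_integralHodgeClassesIn_iff Φ).1 hyH).1⟩,
      (hN s _).2 ⟨m, i, hm, h₀, y, hyH, hyP, rfl⟩, ?_⟩
    show (u : E [⋀^Fin (k + 2)]→L[ℝ] ℂ) = (lefschetzPow η s h₀ y).wedge (ofRealForm η : E [⋀^Fin 2]→L[ℝ] ℂ)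
    rw [huy, ← lefschetzPow_one_eq_wedge_ofRealForm η h1, lefschetzPow_lefschetzPow]
    exact lefschetzPow_congr₈₈ η (by simp [Nat.add_comm]) _ _ y
  · rintro ⟨v, hv, huv⟩
    obtain ⟨m, i, hm, h₀, y, hyH, hyP, hvy⟩ := (hN s v).1 hv
    refine (hN' (Fin.succ s) u).2 ⟨m, i, hm, by simp; omega, y, hyH, hyP, ?_⟩
    rw [huv, hvy, ← lefschetzPow_one_eq_wedge_ofRealForm η h1, lefschetzPow_lefschetzPow]
    exact lefschetzPow_congr₈₈ η (by simp [Nat.add_comm]) _ _ y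

omit [Fintype ι] [DecidableEq ι] in
/-- **`N_0 = Hdgᵖ(X, ℤ) ∩ P^k`** (`k = p + p`): the `0`-th Lefschetz piece is the primitive integral Hodge lattice itself (`L⁰ = id`).
[cite: Lange2023AbelianVarietiesComplex, §7.3.2 (3)] [cite: VoisinHodgeI2002, §6.2.3 Rem. 6.27 (PDF p. 126)] -/
theorem mem_lefschetzPiece_zero_iff (η : E [⋀^Fin 2]→L[ℝ] ℝ) (hpk : p + p = k) (N : Fin (p + 1) → Submodule ℤ ↥(integralForms Φ k))
    (hN : ∀ (s : Fin (p + 1)) (u : ↥(integralForms Φ k)), u ∈ N s ↔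
      ∃ (m i : ℕ) (_ : i + i = m) (h : 2 * (s : ℕ) + m = k) (y : E [⋀^Fin m]→L[ℝ] ℂ),
        y ∈ integralHodgeClassesIn Φ m i ∧ y ∈ primitiveForms η m ∧ (u : E [⋀^Fin k]→L[ℝ] ℂ) = lefschetzPow η (s : ℕ) h y)
    (u : ↥(integralForms Φ k)) :
    u ∈ N 0 ↔ (u : E [⋀^Fin k]→L[ℝ] ℂ) ∈ integralHodgeClassesIn Φ k p ∧ (u : E [⋀^Fin k]→L[ℝ] ℂ) ∈ primitiveForms η k := by
  have h0 : 2 * ((0 : Fin (p + 1)) : ℕ) + k = k := by simp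
  constructor
  · intro hu
    obtain ⟨m, i, hm, h, y, hyH, hyP, huy⟩ := (hN 0 u).1 hu
    have hmk : k = m := by simp at h; omega
    subst hmk
    have hip : p = i := by omega
    subst hip
    have huy' : (u : E [⋀^Fin k]→L[ℝ] ℂ) = y := by
      rw [huy, lefschetzPow_congr₈₈ η (show ((0 : Fin (p + 1)) : ℕ) = 0 from rfl) h (by ring), lefschetzPow_zero_apply]
    rw [huy']
    exact ⟨hyH, hyP⟩
  · rintro ⟨huH, huP⟩
    refine (hN 0 u).2 ⟨k, p, hpk, h0, _, huH, huP, ?_⟩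
    rw [lefschetzPow_congr₈₈ η (show ((0 : Fin (p + 1)) : ℕ) = 0 from rfl) h0 (by ring), lefschetzPow_zero_apply]

/-! ## §4 The discriminant shift of the Lefschetz pieces -/

/-- **`disc(N'_{s+1}) = c^{rk N_s} · disc(N_s)`**, `c = (q+1)(q+2)·d_{q+1}·d_{q+2}` (`k + 2 + q = g`): every basis `b` of the `s`-th Lefschetz piece in
degree `k` is carried by `· ∧ θ` to a basis `b₂` of the `(s+1)`-st piece in degree `k + 2` (§2, §3), in which the Gram determinant of `B_{k+2}` is
`c^{rk}` times that of `B_k` in `b` (§1) — the discriminants of the pieces `Lˢ Hdgⁱ(X, ℤ)_prim`, `s = 0, 1, …`, over a FIXED primitive Hodge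
lattice `Hdgⁱ(X, ℤ) ∩ P^{2i}` grow by the explicit factors `c^{ρ_pr^{(i)}}` along the ladder.
[cite: Lange2023AbelianVarietiesComplex, §5.4.1 Thm. 5.4.2 and (5.22) (PDF p. 275); §7.3.2 (3); §1.5.1 (PDF p. 51)] [cite: Huybrechts2016K3, Ch. 14 §0.1, §0.2]
[cite: Kitaoka1993, Ch. 5 §5.3 Prop. 5.3.3 (proof)] [cite: VoisinHodgeI2002, §6.3.2 Lemma 6.31 (PDF p. 128)] -/
theorem IsPolarizationType.exists_basis_det_restrict_lefschetzPiece_succ_eq (hd : IsPolarizationType Φ η d) (hη : IsRiemannForm Φ η)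
    (hkq : k + 2 + q = j + 2) (hq : q ≤ j + 2) {γ : E [⋀^Fin (2 * q)]→L[ℝ] ℂ}
    (hγ : wedgePow (ofRealForm η) q = ((q.factorial * ∏ i : Fin q, d (Fin.castLE hq i) : ℕ) : ℂ) • γ)
    (hq2 : q + 1 + 1 ≤ j + 2) {γ' : E [⋀^Fin (2 * (q + 1 + 1))]→L[ℝ] ℂ}
    (hγ' : wedgePow (ofRealForm η) (q + 1 + 1) = (((q + 1 + 1).factorial * ∏ i : Fin (q + 1 + 1), d (Fin.castLE hq2 i) : ℕ) : ℂ) • γ')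
    (e : Fin n ≃ ι) (hn : k + 2 + (2 * q + (k + 2)) = n) (hn₂ : k + (2 * (q + 1 + 1) + k) = n)
    {B : BilinForm ℤ ↥(integralForms Φ (k + 2))}
    (hB : ∀ x y : ↥(integralForms Φ (k + 2)),
      ((B x y : ℤ) : ℂ) = poincarePairing Φ e hn (x : E [⋀^Fin (k + 2)]→L[ℝ] ℂ) (γ.wedge (y : E [⋀^Fin (k + 2)]→L[ℝ] ℂ)))
    {B' : BilinForm ℤ ↥(integralForms Φ k)}
    (hB' : ∀ x y : ↥(integralForms Φ k),
      ((B' x y : ℤ) : ℂ) = poincarePairing Φ e hn₂ (x : E [⋀^Fin k]→L[ℝ] ℂ) (γ'.wedge (y : E [⋀^Fin k]→L[ℝ] ℂ)))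
    (N : Fin (p + 1) → Submodule ℤ ↥(integralForms Φ k))
    (hN : ∀ (s : Fin (p + 1)) (u : ↥(integralForms Φ k)), u ∈ N s ↔
      ∃ (m i : ℕ) (_ : i + i = m) (h : 2 * (s : ℕ) + m = k) (y : E [⋀^Fin m]→L[ℝ] ℂ),
        y ∈ integralHodgeClassesIn Φ m i ∧ y ∈ primitiveForms η m ∧ (u : E [⋀^Fin k]→L[ℝ] ℂ) = lefschetzPow η (s : ℕ) h y)
    (N' : Fin (p + 1 + 1) → Submodule ℤ ↥(integralForms Φ (k + 2)))
    (hN' : ∀ (s : Fin (p + 1 + 1)) (u : ↥(integralForms Φ (k + 2))), u ∈ N' s ↔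
      ∃ (m i : ℕ) (_ : i + i = m) (h : 2 * (s : ℕ) + m = k + 2) (y : E [⋀^Fin m]→L[ℝ] ℂ),
        y ∈ integralHodgeClassesIn Φ m i ∧ y ∈ primitiveForms η m ∧ (u : E [⋀^Fin (k + 2)]→L[ℝ] ℂ) = lefschetzPow η (s : ℕ) h y)
    (s : Fin (p + 1)) {κ : Type*} [Fintype κ] [DecidableEq κ] (b : Basis κ ℤ ↥(N s)) :
    ∃ b₂ : Basis κ ℤ ↥(N' (Fin.succ s)),
      (∀ i, (((b₂ i : ↥(N' (Fin.succ s))) : ↥(integralForms Φ (k + 2))) : E [⋀^Fin (k + 2)]→L[ℝ] ℂ) =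
        (((b i : ↥(N s)) : ↥(integralForms Φ k)) : E [⋀^Fin k]→L[ℝ] ℂ).wedge (ofRealForm η : E [⋀^Fin 2]→L[ℝ] ℂ)) ∧
      (LinearMap.BilinForm.toMatrix b₂ (B.restrict (N' (Fin.succ s)))).det =
        (((q + 1) * (q + 2) * d (Fin.castLE hq2 (Fin.last q).castSucc) * d (Fin.castLE hq2 (Fin.last (q + 1))) : ℕ) : ℤ) ^ Fintype.card κ *
          (LinearMap.BilinForm.toMatrix b (B'.restrict (N s))).det := by
  obtain ⟨b₂, hb₂⟩ := hd.exists_basis_coe_eq_wedge hη (by omega : k + 1 ≤ j + 2)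
    (hη.mem_lefschetzPiece_succ_iff N hN N' hN' s) b
  exact ⟨b₂, hb₂, hd.det_restrict_eq_pow_mul_det_of_coe_eq_wedge hη hq hγ hq2 hγ' e hn hn₂ hB hB' b b₂ hb₂⟩

end Similarity

end Literature.Geometry.Kaehler.ComplexTorus

end
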